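import Literature.MathematicalPhysics.QuantumFieldTheory.BalabanImbrieJaffe1984to88.BIJ88Regularity286
import Literature.MathematicalPhysics.QuantumFieldTheory.BalabanImbrieJaffe1984to88.BIJ88Sect5StatementsPart3

/-!
# `BalabanImbrieJaffe1984to88.BIJ88Smooth43Phase` — T. Bałaban, J. Imbrie, A. Jaffe, *Effective action and cluster properties of the
abelian Higgs model*, Commun. Math. Phys. **114** (1988) 257–315 [BalabanImbrieJaffe1988], Sect. 5.6 p. 286 [PDF 30]: the ALGEBRA of
the regularity condition (4.3) under PHASE FACTORS — *"The first operation we performed was a translation, which of course does not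
spoil the regularity of u_k. We then made a gauge transformation and removed the small kernel w₁. … ∂w₁, ∂*w₁ are small, so the
bounds remain valid. … Thus removing θ_kH_{k,loc}A^{(k)} does not spoil the regularity"* — PROVED over r18's predicate
`BIJ88Sect4Statements.Smooth43` and r16's cube-family predicate `BIJ88Regularity286.Regular286`; theorems only.

statement-level skeleton of published theorems with citation tags; proofs where landed; nothing here is a claim about the Yang–Mills mass gap

PDF held: `paper:balaban1988-cmp114-bij-abelian-higgs-effective-action` (journal page = PDF page + 256); p. 286 [PDF 30] read this
session on the store's text layer and against r16's image read quoted in `BIJ88Regularity286`.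

CITATION HEADER (lean-in-tree rule).  Part of the lit-balaban TYPED SKELETON (HOME `run/shared/lean/pub/lit-balaban/`), PHASE-2
proof seat p36 gen 6 (unit `lit-balaban-p36`; TAKING line HOME/STATUS.md 2026-08-21T10:12Z; companions: this seat's
`BIJ88Smooth43Axial`/`BIJ88Smooth43AxialRegular` = the p. 286 step «first checking it for u», p31 gen 6's `BIJ88Eq564Torus` =
(5.6.3)–(5.6.4) and «Q^{s*}_k e^{ie_k∂λ} is a gauge transformation»).  WHAT IS REPRODUCED: located sentences of row **C2.Claim@286**
(owner r16, `ROWS-C2-part2.md`).  r16's `BIJ88Regularity286` proves the two OTHER printed mechanisms (*"In Λ̄₁^{(k)*c} we have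
ũ_{k+1} = u_k"* — `regular286_of_eqOn`; *"The gauge transformation does not change the regularity"* — `regular286_gaugeU_iff`).

THE PRINT, p. 286 [PDF 30], verbatim.  *"Our desired bound now follows because by (5.4.4), (Q^s_k − 𝒟_{k,loc}∂*Q^{e*}_k∂)□′B =
(H_{k,loc} + ∂C_k + w₁)□′B. (5.6.5) The kernels H_{k,loc}, w₁ and their derivatives are bounded, so A^λ, ∂A^λ, ∂*A^λ are finally all
bounded by cp(e_k)r(e_k). The first operation we performed was a translation, which of course does not spoil the regularity of u_k.
We then made a gauge transformation and removed the small kernel w₁. The gauge transformation does not change the regularity, and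
∂w₁, ∂*w₁ are small, so the bounds remain valid. After another translation we removed the field θ_kH_{k,loc}A^{(k)}. This field
satisfies ∂(θ_kH_{k,loc}A^{(k)}) ≦ cp(e_k) because A^{(k)} ≦ cp(e_k) and because ∂H_{k,loc}, H_{k,loc}, and derivatives of θ_k are
bounded. Similarly ∂*(θ_kH_{k,loc}A^{(k)}), θ_kH_{k,loc}A^{(k)} are bounded by cp(e_k). Thus removing θ_kH_{k,loc}A^{(k)} does not spoil the
regularity, and ũ_{k+1} satisfies the regularity condition."*  ((4.3) p. 274: *"there exists a gauge transformation u_k → u_k^λ such that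
u^λ_{k,b} = exp(ie_jL^{−j}A^λ_b) with |A^λ_b|, |(∂^ζA^λ)(p)|, |(∂^{ζ*}A^λ)(x)| ≦ cp(e_j)r(e_j) (4.3) in □"*.)

THE MECHANISM, as a statement about r18's predicate `Smooth43 e ζ c p r X B Pl u` (∃ λ, A: `u^λ = e^{ieζA}` on the bonds `B` of the
cube, `|A| ≦ cpr` on `B`, `|∂^ζA| ≦ cpr` on the plaquettes `Pl`, `|∂^{ζ*}A| ≦ cpr` on the sites `X`).  Every operation of the list above
multiplies the background field by a PHASE FIELD `e^{±ieζg}` — the translations (5.3.3)/(5.5.13)/(5.6.1) (r16's `bgExp e ζ Q X =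
Q·e^{ieζX}`, r18's (4.2) `backgroundU e ζ Q g = Q·e^{−ieζg}`), the removal of `w₁A′` and of `θ_kH_{k,loc}A^{(k)}` — with a field `g`
whose three quantities `|g|`, `|∂^ζg|`, `|∂^{ζ*}g|` are bounded (by `c′pr`; in print `≦ cp(e_k)`, *"small"*).  Then the SAME gauge
function `λ` and the potential `A ± g` witness (4.3) for the new field with constant `c + c′`: `(u·e^{±ieζg})^λ = u^λ·e^{±ieζg} =
e^{ieζ(A ± g)}`, and `∂^ζ`, `∂^{ζ*}` are linear (`LatticeFieldCalculus.curl_add/curl_sub/diverg_sub`).  A pure phase `e^{ieζg}` is the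
case `u ≡ 1` (`λ = 0`, `A = g`) — the form in which *"A^λ, ∂A^λ, ∂*A^λ are finally all bounded by cp(e_k)r(e_k)"* concludes for the
field `exp ie_kη[(Q^s_k − 𝒟_{k,loc}∂*Q^{e*}_k∂)□′B]` of (5.6.4) once (5.6.5) and the kernel bounds supply the three bounds.

WHAT IS PROVED (0 `sorry`, standard axioms; theorems only, no `def`).
* §1 `gaugeU_mul` (r18's `gaugeU λ (u·w) = (gaugeU λ u)·w` for a gauge-invariant factor `w`), **`smooth43_exp`** (a pure phase
  `b ↦ e^{ieζg(b)}` with the three bounds is (4.3)-smooth, `λ = 0`), `smooth43_phaseCfg` (r18's `phaseCfg θ`, `θ = eζ·g`).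
* §2 **`smooth43_mul_exp`** (`Smooth43 … c … u` and the three bounds on `g` at `c′` ⟹ `Smooth43 … (c + c′) … (u·e^{ieζg})`),
  `smooth43_mul_exp_neg` (`u·e^{−ieζg}`), **`smooth43_bgExp`** (r16's translation form `bgExp e ζ Q X`: smooth `Q` + bounded `X` ⟹ smooth
  `bgExp`), **`smooth43_backgroundU`** (r18's (4.2)/(5.6.3) form `backgroundU e ζ Q g`), and the converses **`smooth43_of_bgExp`** /
  `smooth43_of_backgroundU` (*"removing"* a bounded field: smooth `Q·e^{ieζX}` + bounded `X` ⟹ smooth `Q`).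
* §3 the cube-family versions over r16's `Regular286`: `regular286_exp`, `regular286_bgExp`, `regular286_backgroundU`,
  `regular286_of_bgExp`, `regular286_of_backgroundU` (bounds asked on the bonds/plaquettes/sites of the cubes of the family).
* §4 (v1.1) *"The kernels H_{k,loc}, w₁ and their derivatives are bounded, so A^λ, ∂A^λ, ∂*A^λ are finally all bounded"* as a hence-step
  for a kernel field `g = KB` (`(H_{k,loc} + ∂C_k + w₁)□′B` of (5.6.5), `θ_kH_{k,loc}A^{(k)}`): `abs_kernel_apply_le`, `curl_kernel_apply` /
  `diverg_kernel_apply` (the differentiated kernels), **`smooth43_exp_kernel`** (row sums of `K`, `∂^ζK`, `∂^{ζ*}K` bounded by `K₀, K₁, K₂`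
  and `|B| ≦ M` with `K_iM ≦ cpr` ⟹ `e^{ieζ·KB}` is (4.3)-smooth).
HONEST SCOPE.  Book-keeping of the printed mechanism only: the BOUNDS on the removed fields and kernels (`∂w₁, ∂*w₁ small`; `θ_kH_{k,loc}A^{(k)}`,
`∂(·)`, `∂*(·)` `≦ cp(e_k)` from `A^{(k)} ≦ cp(e_k)` and the boundedness of `H_{k,loc}`, `∂H_{k,loc}`, derivatives of `θ_k`; the kernel
bounds behind (5.6.5)) are displayed hypotheses here, as in r16's `BIJ88Regularity286`; nothing of [2]'s kernel analysis is asserted.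
Seat p36 gen 6 (literature-prover-lit-balaban-p36-g6-0), 2026-08-21.  NOT summit progress.
-/

namespace Literature.MathematicalPhysics.QuantumFieldTheory.BalabanImbrieJaffe1984to88.BIJ88Smooth43Phase

open Literature.MathematicalPhysics.QuantumFieldTheory.Balaban1983to89
open BIJ88Sect3Statements (gaugeU phaseCfg starB starP)
open BIJ88Sect4Statements (Smooth43 backgroundU)
open BIJ88Regularity286 (Regular286 cubeSites)
open BIJ88Sect5StatementsPart3 (bgExp)
open LatticeFieldCalculus (curl diverg curl_add curl_sub diverg_sub)
open Complex

noncomputable section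

variable {P : Params} {j : ℕ}

/-! ## §1  Gauge transformations commute with phase factors; pure phases are (4.3)-smooth -/

/-- r18's gauge action is multiplicative in a factor carrying no gauge weight: `(u·w)^λ = u^λ·w` pointwise.
[cite: BalabanImbrieJaffe1988, (4.3) p.286] -/
theorem gaugeU_mul (lam : Balaban1983to89.Site P j → ℝ) (u w : PBond P j → ℂ) (b : PBond P j) :
    gaugeU lam (fun b => u b * w b) b = gaugeU lam u b * w b := by
  simp only [gaugeU]; ring

/-- The phase of a sum is the product of the phases: `e^{ieζ(A+g)} = e^{ieζA}·e^{ieζg}` (in r18's typing of the exponent).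
[cite: BalabanImbrieJaffe1988, (4.3) p.286] -/
theorem exp_phase_add (e ζ a g : ℝ) :
    exp (I * ((e * ζ * (a + g) : ℝ) : ℂ)) = exp (I * ((e * ζ * a : ℝ) : ℂ)) * exp (I * ((e * ζ * g : ℝ) : ℂ)) := by
  rw [← Complex.exp_add]; congr 1; push_cast; ring

/-- `e^{ieζ(A−g)} = e^{ieζA}·e^{−ieζg}`. [cite: BalabanImbrieJaffe1988, (4.3) p.286] -/
theorem exp_phase_sub (e ζ a g : ℝ) :
    exp (I * ((e * ζ * (a - g) : ℝ) : ℂ)) = exp (I * ((e * ζ * a : ℝ) : ℂ)) * exp (-(I * ((e * ζ * g : ℝ) : ℂ))) := by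
  rw [← Complex.exp_add]; congr 1; push_cast; ring

/-- **A PURE PHASE FIELD IS (4.3)-SMOOTH** — the form in which p. 286 concludes *"so A^λ, ∂A^λ, ∂*A^λ are finally all bounded by
cp(e_k)r(e_k)"*: if `|g| ≦ cpr` on the bonds, `|∂^ζg| ≦ cpr` on the plaquettes and `|∂^{ζ*}g| ≦ cpr` on the sites of the cube, then
`u = e^{ieζg}` satisfies `Smooth43 e ζ c p r X B Pl u` with `λ = 0`, `A^λ = g`. [cite: BalabanImbrieJaffe1988, (4.3) p.286] -/
theorem smooth43_exp {e ζ c pej rej : ℝ} {X : Finset (Balaban1983to89.Site P j)} {B : Finset (PBond P j)} {Pl : Finset (Plaq P j)}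
    {g : VecField P j ℝ} (hg : ∀ b ∈ B, |g b| ≤ c * pej * rej) (hcurl : ∀ p ∈ Pl, |curl ζ⁻¹ g p| ≤ c * pej * rej)
    (hdiv : ∀ x ∈ X, |diverg ζ⁻¹ g x| ≤ c * pej * rej) :
    Smooth43 e ζ c pej rej X B Pl (fun b => exp (I * ((e * ζ * g b : ℝ) : ℂ))) := by
  refine ⟨fun _ => 0, g, fun b _ => ?_, hg, hcurl, hdiv⟩
  simp [gaugeU]

/-- The same for r18's phase parametrization `phaseCfg θ`, `θ = eζ·g`. [cite: BalabanImbrieJaffe1988, (4.3) p.286] -/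
theorem smooth43_phaseCfg {e ζ c pej rej : ℝ} {X : Finset (Balaban1983to89.Site P j)} {B : Finset (PBond P j)}
    {Pl : Finset (Plaq P j)} {g : VecField P j ℝ} (hg : ∀ b ∈ B, |g b| ≤ c * pej * rej)
    (hcurl : ∀ p ∈ Pl, |curl ζ⁻¹ g p| ≤ c * pej * rej) (hdiv : ∀ x ∈ X, |diverg ζ⁻¹ g x| ≤ c * pej * rej) :
    Smooth43 e ζ c pej rej X B Pl (phaseCfg fun b => e * ζ * g b) := by
  have h := smooth43_exp (e := e) (ζ := ζ) hg hcurl hdiv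
  have hcfg : (phaseCfg fun b => e * ζ * g b : PBond P j → ℂ) = fun b => exp (I * ((e * ζ * g b : ℝ) : ℂ)) := by
    funext b; simp only [phaseCfg, mul_comm I]
  rw [hcfg]; exact h

/-! ## §2  Multiplying by a bounded phase field keeps (4.3) — «translation … removing … does not spoil the regularity» -/

/-- **«does not spoil the regularity», additive form**: if `u` is (4.3)-smooth on a cube with constant `c` and `g` satisfies the three
bounds with constant `c′`, then `u·e^{ieζg}` is (4.3)-smooth with constant `c + c′` (same gauge function, potential `A + g`).
[cite: BalabanImbrieJaffe1988, (4.3) p.286] -/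
theorem smooth43_mul_exp {e ζ c c' pej rej : ℝ} {X : Finset (Balaban1983to89.Site P j)} {B : Finset (PBond P j)}
    {Pl : Finset (Plaq P j)} {u : PBond P j → ℂ} {g : VecField P j ℝ} (hu : Smooth43 e ζ c pej rej X B Pl u)
    (hg : ∀ b ∈ B, |g b| ≤ c' * pej * rej) (hcurl : ∀ p ∈ Pl, |curl ζ⁻¹ g p| ≤ c' * pej * rej)
    (hdiv : ∀ x ∈ X, |diverg ζ⁻¹ g x| ≤ c' * pej * rej) :
    Smooth43 e ζ (c + c') pej rej X B Pl (fun b => u b * exp (I * ((e * ζ * g b : ℝ) : ℂ))) := by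
  obtain ⟨lam, A, h1, h2, h3, h4⟩ := hu
  refine ⟨lam, fun b => A b + g b, fun b hb => ?_, fun b hb => ?_, fun p hp => ?_, fun x hx => ?_⟩
  · rw [gaugeU_mul, h1 b hb, exp_phase_add]
  · calc |A b + g b| ≤ |A b| + |g b| := abs_add_le _ _
      _ ≤ c * pej * rej + c' * pej * rej := add_le_add (h2 b hb) (hg b hb)
      _ = (c + c') * pej * rej := by ring
  · rw [curl_add]
    calc |curl ζ⁻¹ A p + curl ζ⁻¹ g p| ≤ |curl ζ⁻¹ A p| + |curl ζ⁻¹ g p| := abs_add_le _ _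
      _ ≤ c * pej * rej + c' * pej * rej := add_le_add (h3 p hp) (hcurl p hp)
      _ = (c + c') * pej * rej := by ring
  · have hd : diverg ζ⁻¹ (fun b => A b + g b) x = diverg ζ⁻¹ A x + diverg ζ⁻¹ g x := by
      have := congrFun (diverg_sub ζ⁻¹ (fun b => A b + g b) g) x
      simp only [add_sub_cancel_right] at this
      linarith
    rw [hd]
    calc |diverg ζ⁻¹ A x + diverg ζ⁻¹ g x| ≤ |diverg ζ⁻¹ A x| + |diverg ζ⁻¹ g x| := abs_add_le _ _
      _ ≤ c * pej * rej + c' * pej * rej := add_le_add (h4 x hx) (hdiv x hx)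
      _ = (c + c') * pej * rej := by ring

/-- **«removing the field … does not spoil the regularity»**: the same with the phase `e^{−ieζg}` (potential `A − g`).
[cite: BalabanImbrieJaffe1988, (4.3) p.286] -/
theorem smooth43_mul_exp_neg {e ζ c c' pej rej : ℝ} {X : Finset (Balaban1983to89.Site P j)} {B : Finset (PBond P j)}
    {Pl : Finset (Plaq P j)} {u : PBond P j → ℂ} {g : VecField P j ℝ} (hu : Smooth43 e ζ c pej rej X B Pl u)
    (hg : ∀ b ∈ B, |g b| ≤ c' * pej * rej) (hcurl : ∀ p ∈ Pl, |curl ζ⁻¹ g p| ≤ c' * pej * rej)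
    (hdiv : ∀ x ∈ X, |diverg ζ⁻¹ g x| ≤ c' * pej * rej) :
    Smooth43 e ζ (c + c') pej rej X B Pl (fun b => u b * exp (-(I * ((e * ζ * g b : ℝ) : ℂ)))) := by
  have hneg : ∀ b, exp (-(I * ((e * ζ * g b : ℝ) : ℂ))) = exp (I * ((e * ζ * (fun b => -g b) b : ℝ) : ℂ)) := fun b => by
    congr 1; push_cast; ring
  simp_rw [hneg]
  refine smooth43_mul_exp hu (fun b hb => ?_) (fun p hp => ?_) (fun x hx => ?_)
  · rw [abs_neg]; exact hg b hb
  · have : curl ζ⁻¹ (fun b => -g b) p = -curl ζ⁻¹ g p := by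
      have h0 := curl_sub ζ⁻¹ (fun _ => (0 : ℝ)) g p
      simp only [zero_sub] at h0
      rw [h0]; simp [curl]
    rw [this, abs_neg]; exact hcurl p hp
  · have : diverg ζ⁻¹ (fun b => -g b) x = -diverg ζ⁻¹ g x := by
      have h0 := congrFun (diverg_sub ζ⁻¹ (fun _ => (0 : ℝ)) g) x
      simp only [zero_sub] at h0
      rw [h0]; simp [diverg]
    rw [this, abs_neg]; exact hdiv x hx

/-- **THE TRANSLATION FORM** (r16's `bgExp e ζ Q X = Q·e^{ieζX}` of (5.3.4)/(5.5.13)/(5.6.1)): *"a translation … does not spoil the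
regularity"* — a (4.3)-smooth `Q` times the phase of a field `X` with the three bounds is (4.3)-smooth, constant `c + c′`.
[cite: BalabanImbrieJaffe1988, (4.3) p.286] -/
theorem smooth43_bgExp {e ζ c c' pej rej : ℝ} {Xs : Finset (Balaban1983to89.Site P j)} {B : Finset (PBond P j)}
    {Pl : Finset (Plaq P j)} {Q : PBond P j → ℂ} {X : PBond P j → ℝ} (hQ : Smooth43 e ζ c pej rej Xs B Pl Q)
    (hX : ∀ b ∈ B, |X b| ≤ c' * pej * rej) (hcurl : ∀ p ∈ Pl, |curl ζ⁻¹ X p| ≤ c' * pej * rej)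
    (hdiv : ∀ x ∈ Xs, |diverg ζ⁻¹ X x| ≤ c' * pej * rej) :
    Smooth43 e ζ (c + c') pej rej Xs B Pl (bgExp e ζ Q X) :=
  smooth43_mul_exp hQ hX hcurl hdiv

/-- **THE (4.2)/(5.6.3) FORM** (r18's `backgroundU e ζ Q g = Q·e^{−ieζg}`, `u_k = (Q^{s*}_ku)·exp[−ie_kη𝒟_{k,loc}∂*Q^{e*}_kf^{(k)}]`):
a (4.3)-smooth `Q` times `e^{−ieζg}` with the three bounds on `g` is (4.3)-smooth, constant `c + c′`. [cite: BalabanImbrieJaffe1988, (4.3) p.286] -/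
theorem smooth43_backgroundU {e ζ c c' pej rej : ℝ} {X : Finset (Balaban1983to89.Site P j)} {B : Finset (PBond P j)}
    {Pl : Finset (Plaq P j)} {Q : PBond P j → ℂ} {g : PBond P j → ℝ} (hQ : Smooth43 e ζ c pej rej X B Pl Q)
    (hg : ∀ b ∈ B, |g b| ≤ c' * pej * rej) (hcurl : ∀ p ∈ Pl, |curl ζ⁻¹ g p| ≤ c' * pej * rej)
    (hdiv : ∀ x ∈ X, |diverg ζ⁻¹ g x| ≤ c' * pej * rej) :
    Smooth43 e ζ (c + c') pej rej X B Pl (backgroundU e ζ Q g) :=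
  smooth43_mul_exp_neg hQ hg hcurl hdiv

/-- Undoing a phase: `(Q·e^{ieζX})·e^{−ieζX} = Q`. [cite: BalabanImbrieJaffe1988, (4.3) p.286] -/
theorem bgExp_mul_exp_neg (e ζ : ℝ) (Q : PBond P j → ℂ) (X : PBond P j → ℝ) (b : PBond P j) :
    bgExp e ζ Q X b * exp (-(I * ((e * ζ * X b : ℝ) : ℂ))) = Q b := by
  simp only [bgExp]
  rw [mul_assoc, ← Complex.exp_add, add_neg_cancel, Complex.exp_zero, mul_one]

/-- Undoing a phase: `(Q·e^{−ieζg})·e^{ieζg} = Q`. [cite: BalabanImbrieJaffe1988, (4.3) p.286] -/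
theorem backgroundU_mul_exp (e ζ : ℝ) (Q : PBond P j → ℂ) (g : PBond P j → ℝ) (b : PBond P j) :
    backgroundU e ζ Q g b * exp (I * ((e * ζ * g b : ℝ) : ℂ)) = Q b := by
  simp only [backgroundU]
  rw [mul_assoc, ← Complex.exp_add, neg_add_cancel, Complex.exp_zero, mul_one]

/-- **«REMOVING» a bounded field, converse form**: if the translated field `Q·e^{ieζX}` is (4.3)-smooth with constant `c` and `X`
satisfies the three bounds with `c′`, then `Q` itself is (4.3)-smooth with constant `c + c′`. [cite: BalabanImbrieJaffe1988, (4.3) p.286] -/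
theorem smooth43_of_bgExp {e ζ c c' pej rej : ℝ} {Xs : Finset (Balaban1983to89.Site P j)} {B : Finset (PBond P j)}
    {Pl : Finset (Plaq P j)} {Q : PBond P j → ℂ} {X : PBond P j → ℝ} (h : Smooth43 e ζ c pej rej Xs B Pl (bgExp e ζ Q X))
    (hX : ∀ b ∈ B, |X b| ≤ c' * pej * rej) (hcurl : ∀ p ∈ Pl, |curl ζ⁻¹ X p| ≤ c' * pej * rej)
    (hdiv : ∀ x ∈ Xs, |diverg ζ⁻¹ X x| ≤ c' * pej * rej) : Smooth43 e ζ (c + c') pej rej Xs B Pl Q := by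
  have h' := smooth43_mul_exp_neg h hX hcurl hdiv
  have hQ : (fun b => bgExp e ζ Q X b * exp (-(I * ((e * ζ * X b : ℝ) : ℂ)))) = Q := funext fun b => bgExp_mul_exp_neg e ζ Q X b
  rwa [hQ] at h'

/-- The same for r18's form: `Q·e^{−ieζg}` smooth with `c` and `g` bounded with `c′` ⟹ `Q` smooth with `c + c′`.
[cite: BalabanImbrieJaffe1988, (4.3) p.286] -/
theorem smooth43_of_backgroundU {e ζ c c' pej rej : ℝ} {X : Finset (Balaban1983to89.Site P j)} {B : Finset (PBond P j)}
    {Pl : Finset (Plaq P j)} {Q : PBond P j → ℂ} {g : PBond P j → ℝ} (h : Smooth43 e ζ c pej rej X B Pl (backgroundU e ζ Q g))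
    (hg : ∀ b ∈ B, |g b| ≤ c' * pej * rej) (hcurl : ∀ p ∈ Pl, |curl ζ⁻¹ g p| ≤ c' * pej * rej)
    (hdiv : ∀ x ∈ X, |diverg ζ⁻¹ g x| ≤ c' * pej * rej) : Smooth43 e ζ (c + c') pej rej X B Pl Q := by
  have h' := smooth43_mul_exp h hg hcurl hdiv
  have hQ : (fun b => backgroundU e ζ Q g b * exp (I * ((e * ζ * g b : ℝ) : ℂ))) = Q := funext fun b => backgroundU_mul_exp e ζ Q g b
  rwa [hQ] at h'

/-! ## §3  The cube-family versions over r16's `Regular286` -/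

/-- A pure phase field with the three bounds on every cube of the family satisfies the regularity condition of p. 286.
[cite: BalabanImbrieJaffe1988, (4.3) p.286] -/
theorem regular286_exp {γ : Type*} {cube : Balaban1983to89.Site P j → γ} {G : Set γ} {e ζ c pej rej : ℝ} {g : VecField P j ℝ}
    (hg : ∀ q ∈ G, ∀ b ∈ starB (cubeSites cube q), |g b| ≤ c * pej * rej)
    (hcurl : ∀ q ∈ G, ∀ p ∈ starP (cubeSites cube q), |curl ζ⁻¹ g p| ≤ c * pej * rej)
    (hdiv : ∀ q ∈ G, ∀ x ∈ cubeSites cube q, |diverg ζ⁻¹ g x| ≤ c * pej * rej) :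
    Regular286 cube G e ζ c pej rej (fun b => exp (I * ((e * ζ * g b : ℝ) : ℂ))) :=
  fun q hq => smooth43_exp (hg q hq) (hcurl q hq) (hdiv q hq)

/-- *"a translation … does not spoil the regularity"*, cube-family form (r16's `bgExp`): `Regular286 … c … Q` and the three bounds on `X`
at `c′` on the cubes of `G` ⟹ `Regular286 … (c + c′) … (bgExp e ζ Q X)`. [cite: BalabanImbrieJaffe1988, (4.3) p.286] -/
theorem regular286_bgExp {γ : Type*} {cube : Balaban1983to89.Site P j → γ} {G : Set γ} {e ζ c c' pej rej : ℝ}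
    {Q : PBond P j → ℂ} {X : PBond P j → ℝ} (hQ : Regular286 cube G e ζ c pej rej Q)
    (hX : ∀ q ∈ G, ∀ b ∈ starB (cubeSites cube q), |X b| ≤ c' * pej * rej)
    (hcurl : ∀ q ∈ G, ∀ p ∈ starP (cubeSites cube q), |curl ζ⁻¹ X p| ≤ c' * pej * rej)
    (hdiv : ∀ q ∈ G, ∀ x ∈ cubeSites cube q, |diverg ζ⁻¹ X x| ≤ c' * pej * rej) :
    Regular286 cube G e ζ (c + c') pej rej (bgExp e ζ Q X) :=
  fun q hq => smooth43_bgExp (hQ q hq) (hX q hq) (hcurl q hq) (hdiv q hq)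

/-- The (4.2)/(5.6.3) form, cube families: `Regular286 … c … Q` and the three bounds on `g` at `c′` ⟹ `Regular286 … (c + c′) …
(backgroundU e ζ Q g)`. [cite: BalabanImbrieJaffe1988, (4.3) p.286] -/
theorem regular286_backgroundU {γ : Type*} {cube : Balaban1983to89.Site P j → γ} {G : Set γ} {e ζ c c' pej rej : ℝ}
    {Q : PBond P j → ℂ} {g : PBond P j → ℝ} (hQ : Regular286 cube G e ζ c pej rej Q)
    (hg : ∀ q ∈ G, ∀ b ∈ starB (cubeSites cube q), |g b| ≤ c' * pej * rej)
    (hcurl : ∀ q ∈ G, ∀ p ∈ starP (cubeSites cube q), |curl ζ⁻¹ g p| ≤ c' * pej * rej)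
    (hdiv : ∀ q ∈ G, ∀ x ∈ cubeSites cube q, |diverg ζ⁻¹ g x| ≤ c' * pej * rej) :
    Regular286 cube G e ζ (c + c') pej rej (backgroundU e ζ Q g) :=
  fun q hq => smooth43_backgroundU (hQ q hq) (hg q hq) (hcurl q hq) (hdiv q hq)

/-- *"removing … does not spoil the regularity"*, cube-family converse (r16's `bgExp`): the translated field regular with `c` and the
removed field bounded with `c′` ⟹ `Q` regular with `c + c′`. [cite: BalabanImbrieJaffe1988, (4.3) p.286] -/
theorem regular286_of_bgExp {γ : Type*} {cube : Balaban1983to89.Site P j → γ} {G : Set γ} {e ζ c c' pej rej : ℝ}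
    {Q : PBond P j → ℂ} {X : PBond P j → ℝ} (h : Regular286 cube G e ζ c pej rej (bgExp e ζ Q X))
    (hX : ∀ q ∈ G, ∀ b ∈ starB (cubeSites cube q), |X b| ≤ c' * pej * rej)
    (hcurl : ∀ q ∈ G, ∀ p ∈ starP (cubeSites cube q), |curl ζ⁻¹ X p| ≤ c' * pej * rej)
    (hdiv : ∀ q ∈ G, ∀ x ∈ cubeSites cube q, |diverg ζ⁻¹ X x| ≤ c' * pej * rej) :
    Regular286 cube G e ζ (c + c') pej rej Q :=
  fun q hq => smooth43_of_bgExp (h q hq) (hX q hq) (hcurl q hq) (hdiv q hq)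

/-- The (4.2)/(5.6.3) converse, cube families. [cite: BalabanImbrieJaffe1988, (4.3) p.286] -/
theorem regular286_of_backgroundU {γ : Type*} {cube : Balaban1983to89.Site P j → γ} {G : Set γ} {e ζ c c' pej rej : ℝ}
    {Q : PBond P j → ℂ} {g : PBond P j → ℝ} (h : Regular286 cube G e ζ c pej rej (backgroundU e ζ Q g))
    (hg : ∀ q ∈ G, ∀ b ∈ starB (cubeSites cube q), |g b| ≤ c' * pej * rej)
    (hcurl : ∀ q ∈ G, ∀ p ∈ starP (cubeSites cube q), |curl ζ⁻¹ g p| ≤ c' * pej * rej)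
    (hdiv : ∀ q ∈ G, ∀ x ∈ cubeSites cube q, |diverg ζ⁻¹ g x| ≤ c' * pej * rej) :
    Regular286 cube G e ζ (c + c') pej rej Q :=
  fun q hq => smooth43_of_backgroundU (h q hq) (hg q hq) (hcurl q hq) (hdiv q hq)


/-! ## §4  «The kernels … and their derivatives are bounded, so A^λ, ∂A^λ, ∂*A^λ are finally all bounded by cp(e_k)r(e_k)» -/

/-- One row of a kernel applied to a bounded bond field, `Σ_{b′} k(b′)B(b′)` — the shape of `(H_{k,loc} + ∂C_k + w₁)□′B` in
(5.6.5) and of `θ_kH_{k,loc}A^{(k)}` (and of their differentiated kernels): `|Σ_{b′} k(b′)B(b′)| ≦ (Σ_{b′}|k(b′)|)·max|B|`.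
[cite: BalabanImbrieJaffe1988, (4.3) p.286] -/
theorem abs_kernel_apply_le {ι : Type*} [Fintype ι] {k B : ι → ℝ} {M K₀ : ℝ} (hB : ∀ b', |B b'| ≤ M)
    (hK : ∑ b', |k b'| ≤ K₀) (hM : 0 ≤ M) : |∑ b', k b' * B b'| ≤ K₀ * M := by
  calc |∑ b', k b' * B b'| ≤ ∑ b', |k b' * B b'| := Finset.abs_sum_le_sum_abs _ _
    _ ≤ ∑ b', |k b'| * M := Finset.sum_le_sum fun b' _ => by
        rw [abs_mul]; exact mul_le_mul_of_nonneg_left (hB b') (abs_nonneg _)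
    _ = (∑ b', |k b'|) * M := by rw [Finset.sum_mul]
    _ ≤ K₀ * M := mul_le_mul_of_nonneg_right hK hM

/-- The curl of a kernel field is the kernel field of the DIFFERENTIATED KERNEL: `∂^ζ(KB)(p) = Σ_{b′} (∂^ζK(·,b′))(p)·B(b′)`
(*"∂H_{k,loc} … bounded"*). [cite: BalabanImbrieJaffe1988, (4.3) p.286] -/
theorem curl_kernel_apply (c : ℝ) (K : PBond P j → PBond P j → ℝ) (B : PBond P j → ℝ) (p : Plaq P j) :
    curl c (fun b => ∑ b', K b b' * B b') p = ∑ b', curl c (fun b => K b b') p * B b' := by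
  simp only [curl, smul_eq_mul, Finset.mul_sum, ← Finset.sum_add_distrib, ← Finset.sum_sub_distrib]
  refine Finset.sum_congr rfl fun b' _ => ?_
  ring

/-- The divergence of a kernel field is the kernel field of the differentiated kernel: `∂^{ζ*}(KB)(x) = Σ_{b′} (∂^{ζ*}K(·,b′))(x)·B(b′)`.
[cite: BalabanImbrieJaffe1988, (4.3) p.286] -/
theorem diverg_kernel_apply (c : ℝ) (K : PBond P j → PBond P j → ℝ) (B : PBond P j → ℝ) (x : Balaban1983to89.Site P j) :
    diverg c (fun b => ∑ b', K b b' * B b') x = ∑ b', diverg c (fun b => K b b') x * B b' := by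
  simp only [diverg, smul_eq_mul, Finset.mul_sum, ← Finset.sum_sub_distrib]
  rw [Finset.sum_comm]
  refine Finset.sum_congr rfl fun b' _ => ?_
  rw [Finset.sum_mul]
  refine Finset.sum_congr rfl fun μ _ => ?_
  ring

/-- **The p. 286 conclusion as a hence-step**: if the kernel `K` (in print `H_{k,loc} + ∂C_k + w₁`, resp. `θ_kH_{k,loc}`) has row sums
`≦ K₀` on the bonds of the cube and its differentiated kernels `∂^ζK`, `∂^{ζ*}K` have row sums `≦ K₁`, `≦ K₂` on the cube's plaquettes
and sites (*"the kernels … and their derivatives are bounded"*), and `|B| ≦ M` (in print `M = cp(e_k)r(e_k)`, resp. `cp(e_k)`), then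
the three quantities of `g = KB` are `≦ K_iM`; hence if `max K_i · M ≦ cpr` the pure phase `e^{ieζ·KB}` is (4.3)-smooth (`smooth43_exp`).
[cite: BalabanImbrieJaffe1988, (4.3) p.286] -/
theorem smooth43_exp_kernel {e ζ c pej rej M K₀ K₁ K₂ : ℝ} {X : Finset (Balaban1983to89.Site P j)} {Bs : Finset (PBond P j)}
    {Pl : Finset (Plaq P j)} {K : PBond P j → PBond P j → ℝ} {B : PBond P j → ℝ} (hM : 0 ≤ M) (hB : ∀ b', |B b'| ≤ M)
    (hK₀ : ∀ b ∈ Bs, ∑ b', |K b b'| ≤ K₀) (hK₁ : ∀ p ∈ Pl, ∑ b', |curl ζ⁻¹ (fun b => K b b') p| ≤ K₁)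
    (hK₂ : ∀ x ∈ X, ∑ b', |diverg ζ⁻¹ (fun b => K b b') x| ≤ K₂) (h₀ : K₀ * M ≤ c * pej * rej) (h₁ : K₁ * M ≤ c * pej * rej)
    (h₂ : K₂ * M ≤ c * pej * rej) :
    Smooth43 e ζ c pej rej X Bs Pl (fun b => exp (I * ((e * ζ * ∑ b', K b b' * B b' : ℝ) : ℂ))) := by
  refine smooth43_exp (g := fun b => ∑ b', K b b' * B b') (fun b hb => ?_) (fun p hp => ?_) (fun x hx => ?_)
  · exact (abs_kernel_apply_le hB (hK₀ b hb) hM).trans h₀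
  · rw [curl_kernel_apply]
    exact (abs_kernel_apply_le hB (hK₁ p hp) hM).trans h₁
  · rw [diverg_kernel_apply]
    exact (abs_kernel_apply_le hB (hK₂ x hx) hM).trans h₂

end

end Literature.MathematicalPhysics.QuantumFieldTheory.BalabanImbrieJaffe1984to88.BIJ88Smooth43Phase
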